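import Literature.Geometry.Kaehler.ComplexTorusAlbertTypeILefschetzGroupConnected
import Literature.Geometry.Kaehler.ComplexTorusQuaternionMultiplicationLefschetzGroupConnected
import Literature.Geometry.Kaehler.ComplexTorusLefschetzGroupConnectedIsogenyFactors
import Literature.Geometry.Kaehler.ComplexTorusAlbertClassificationLowDimension
import HarnessLib

/-!
# Milne's Summary table assembled: `S(X)` is connected for a simple polarised complex torus of Albert type I, II or
# IV (`d = 1`) and disconnected for type III; hence, for dimension `g ≤ 7` (Albert's theorem in the tree),
# `Lf(X)(ℂ) = S(X)(ℂ) ⟺ X` is not of type III (no type IV factor with `d = 2`), unconditionally for odd `g ≤ 7`;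
# and the same through isogeny decompositions `X ∼ ∏ B_k^{n_k}` («connected iff no factor of type III»)

Layer `Literature/Geometry/Kaehler`, namespace `Literature.Geometry.Kaehler.ComplexTorus`; lane `lit-hodgefound`
(Track 2 foundations library), Layer A4 (Lefschetz groups), skeleton seat `lit-hodgefound-skel-4` (generation 35),
row A4-94 (d) = the assembly promised in GAP row A4-90 («with A4-89's
`IsIsogenous.lefschetzIdentityC_eq_lefschetzGroupC_iff_of_powers` these rows give "`S(X)(ℂ)` is connected iff `X` has
no isogeny factor of type III"»), for the types now in the tree. Sequel BY NAME of
`ComplexTorusAlbertTypeILefschetzGroupConnected` (row A4-94 (c): types I and IV with `d = 1`,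
`IsSimple.lefschetzIdentityC_eq_lefschetzGroupC_of_isAlbertTypeI`, `…_of_finrank_eq_one`),
`ComplexTorusQuaternionMultiplicationLefschetzGroupConnected` (p36: type II,
`IsSimple.lefschetzIdentityC_eq_lefschetzGroupC_of_isAlbertTypeII`), `ComplexTorusAlbertTypeIIIStablyDegenerate` /
`ComplexTorusLefschetzGroupConnectedIsogenyFactors` (rows A4-88/A4-89: type III is disconnected,
`IsSimple.lefschetzIdentityC_lt_lefschetzGroupC_of_isAlbertTypeIII`; transfer through `X ∼ ∏ B_k^{n_k}`,
`IsIsogenous.lefschetzIdentityC_eq_lefschetzGroupC_iff_of_powers`) and `ComplexTorusAlbertClassificationLowDimension`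
(p12: Albert's theorem for `g ≤ 7`, `IsSimple.isAlbertType_of_finrank_le_seven`,
`IsSimple.finrank_centerField_endAlgRat_eq_one_of_odd`). THEOREMS ONLY (no definition, no named fact; net debt 0).

## Sources, verbatim

* [Milne1999LefschetzClasses] J. S. Milne, *Lefschetz classes on abelian varieties*, Duke Math. J. 96 (1999), §2
  Summary (p. 652): «The following table summarizes the properties of the reductive groups `S(A)`. Type ∣ Group ∣
  Semisimple ∣ Connected […] I ∣ Sp ∣ Yes ∣ Yes; II ∣ Sp ∣ Yes ∣ Yes; III ∣ O ∣ Yes ∣ No; IV ∣ GL ∣ No ∣ Yes»;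
  §1 Prop. 1.5 (products); Remark 4.9 (p. 661): «When `A` has an isogeny factor of type III […]».
* [MoonenZarhin1999LowDim] B. Moonen, Yu. Zarhin, *Hodge classes on abelian varieties of low dimension*, Math. Ann.
  315 (1999), §2: «a simple `X` of prime dimension cannot be of Type 3» (here: odd `g ≤ 7`, through the tree's
  `IsSimple.finrank_centerField_endAlgRat_eq_one_of_odd`).
* [Lange2023AbelianVarietiesComplex] H. Lange, *Abelian Varieties over the Complex Numbers* (2023), §2.6.1 Proposition
  (the table of restrictions) and §7.2.4 Exercise (4).

## What is proved

* §1 simple tori: `IsSimple.lefschetzIdentityC_eq_lefschetzGroupC_of_isAlbertType` (type I, II, or IV with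
  `[End_ℚ(X) : K] = 1` ⟹ `Lf = S`, every `g`); for `g ≤ 7`:
  **`IsSimple.lefschetzIdentityC_eq_lefschetzGroupC_iff_not_isAlbertTypeIII`** (assuming a type-IV algebra has
  `d = 1` — the case `d = 2` is GAP row A4-90 (IV, `d > 1`)) and, unconditionally,
  **`IsSimple.lefschetzIdentityC_eq_lefschetzGroupC_of_odd`** (`g ∈ {1, 3, 5, 7}`).
* §2 isogeny products `X ∼ ∏ B_k^{n_k}` of simple factors:
  `IsIsogenous.lefschetzIdentityC_eq_lefschetzGroupC_of_powers_of_isAlbertType`,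
  **`IsIsogenous.lefschetzIdentityC_eq_lefschetzGroupC_iff_forall_not_isAlbertTypeIII_of_powers`** (factors of
  dimension `≤ 7`, type-IV factors with `d = 1`): «`S(X)` is connected iff `X` has no isogeny factor of type III».
-/

noncomputable section

open Matrix Module
open Literature.RingTheory.CentralSimple (IsAlbertTypeI IsAlbertTypeII IsAlbertTypeIII IsAlbertTypeIV)

namespace Literature.Geometry.Kaehler

namespace ComplexTorus

/-! ## §1 Simple tori -/

section Simple

variable {κ : Type} [Fintype κ] [DecidableEq κ] [Nonempty κ] {E : Type*} [NormedAddCommGroup E] [NormedSpace ℂ E]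
  {Ψ : (κ → ℝ) ≃L[ℝ] E} {η : E [⋀^Fin 2]→L[ℝ] ℝ} {G : Matrix κ κ ℚ}

/-- **Milne's table, the three «Connected: Yes» rows now in the tree: `Lf(X)(ℂ) = S(X)(ℂ)` for a simple polarised
complex torus of Albert type I, of type II, or of type IV with `[End_ℚ(X) : K] = 1`.**
[cite: Milne1999LefschetzClasses, §2 Summary table (p. 652: «I ∣ Sp ∣ Yes ∣ Yes; II ∣ Sp ∣ Yes ∣ Yes; IV ∣ GL ∣ No ∣ Yes»)] -/
theorem IsSimple.lefschetzIdentityC_eq_lefschetzGroupC_of_isAlbertType (hX : IsSimple Ψ) (hη : IsRiemannForm Ψ η)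
    (hG : G.map (Rat.cast : ℚ → ℝ) = latticeGram Ψ η)
    (h : IsAlbertTypeI (centerField Ψ hX) (endAlgRat Ψ) (rosatiEnd Ψ hη.1 hη.2.2 hG) ∨
      IsAlbertTypeII (centerField Ψ hX) (endAlgRat Ψ) (rosatiEnd Ψ hη.1 hη.2.2 hG) ∨
        (IsAlbertTypeIV (centerField Ψ hX) (endAlgRat Ψ) (rosatiEnd Ψ hη.1 hη.2.2 hG) ∧
          finrank (centerField Ψ hX) (endAlgRat Ψ) = 1)) :
    lefschetzIdentityC Ψ G = lefschetzGroupC Ψ G := by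
  rcases h with h | h | ⟨h, hd⟩
  · exact hX.lefschetzIdentityC_eq_lefschetzGroupC_of_isAlbertTypeI hη hG h
  · exact hX.lefschetzIdentityC_eq_lefschetzGroupC_of_isAlbertTypeII hη hG h
  · exact hX.lefschetzIdentityC_eq_lefschetzGroupC_of_isAlbertTypeIV_of_finrank_eq_one hη hG h hd

variable [FiniteDimensional ℂ E]

/-- **For a simple polarised complex torus of dimension `g ≤ 7` which is not of Albert type III — and whose
endomorphism algebra, if of type IV, is the CM field itself (`d = 1`) — `Lf(X)(ℂ) = S(X)(ℂ)`** (Albert's theorem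
`g ≤ 7` of the tree sorts `X` into the four types; types I, II, IV (`d = 1`) are the «Connected: Yes» rows).
[cite: Milne1999LefschetzClasses, §2 Summary table (p. 652)] [cite: Lange2023AbelianVarietiesComplex, §2.6.1 Proposition] -/
theorem IsSimple.lefschetzIdentityC_eq_lefschetzGroupC_of_not_isAlbertTypeIII (hX : IsSimple Ψ) (hη : IsRiemannForm Ψ η)
    (hG : G.map (Rat.cast : ℚ → ℝ) = latticeGram Ψ η) (hg : finrank ℂ E ≤ 7)
    (hIII : ¬ IsAlbertTypeIII (centerField Ψ hX) (endAlgRat Ψ) (rosatiEnd Ψ hη.1 hη.2.2 hG))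
    (hIV : IsAlbertTypeIV (centerField Ψ hX) (endAlgRat Ψ) (rosatiEnd Ψ hη.1 hη.2.2 hG) →
      finrank (centerField Ψ hX) (endAlgRat Ψ) = 1) :
    lefschetzIdentityC Ψ G = lefschetzGroupC Ψ G := by
  rcases hX.isAlbertType_of_finrank_le_seven hη hG hg with h | h | h | h
  · exact hX.lefschetzIdentityC_eq_lefschetzGroupC_of_isAlbertType hη hG (Or.inl h)
  · exact hX.lefschetzIdentityC_eq_lefschetzGroupC_of_isAlbertType hη hG (Or.inr (Or.inl h))
  · exact absurd h hIII
  · exact hX.lefschetzIdentityC_eq_lefschetzGroupC_of_isAlbertType hη hG (Or.inr (Or.inr ⟨h, hIV h⟩))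

/-- **Milne's table as an equivalence, `g ≤ 7`: `Lf(X)(ℂ) = S(X)(ℂ)` iff the simple polarised torus `X` is NOT of
Albert type III** (for tori whose type-IV endomorphism algebras have `d = 1`; «III ∣ O ∣ Yes ∣ No» is rows A4-88's
`IsSimple.lefschetzIdentityC_lt_lefschetzGroupC_of_isAlbertTypeIII`). [cite: Milne1999LefschetzClasses, §2 Summary table (p. 652) and Remark 4.9]
[cite: Lange2023AbelianVarietiesComplex, §2.6.1 Proposition] -/
theorem IsSimple.lefschetzIdentityC_eq_lefschetzGroupC_iff_not_isAlbertTypeIII (hX : IsSimple Ψ)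
    (hη : IsRiemannForm Ψ η) (hG : G.map (Rat.cast : ℚ → ℝ) = latticeGram Ψ η) (hg : finrank ℂ E ≤ 7)
    (hIV : IsAlbertTypeIV (centerField Ψ hX) (endAlgRat Ψ) (rosatiEnd Ψ hη.1 hη.2.2 hG) →
      finrank (centerField Ψ hX) (endAlgRat Ψ) = 1) :
    lefschetzIdentityC Ψ G = lefschetzGroupC Ψ G ↔
      ¬ IsAlbertTypeIII (centerField Ψ hX) (endAlgRat Ψ) (rosatiEnd Ψ hη.1 hη.2.2 hG) :=
  ⟨fun h hIII ↦ (hX.lefschetzIdentityC_lt_lefschetzGroupC_of_isAlbertTypeIII hη hG hIII).ne h,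
    fun hIII ↦ hX.lefschetzIdentityC_eq_lefschetzGroupC_of_not_isAlbertTypeIII hη hG hg hIII hIV⟩

/-- **Every simple polarised complex torus of ODD dimension `g ≤ 7` (`g = 1, 3, 5, 7`) has connected `S(X)`:
`Lf(X)(ℂ) = S(X)(ℂ)`** — unconditionally: `[End_ℚ(X) : K] = 1` by counting («a simple `X` of prime dimension cannot
be of Type 3»; no type II, no type IV with `d > 1` either). [cite: MoonenZarhin1999LowDim, §2 («cannot be of Type 3»)]
[cite: Milne1999LefschetzClasses, §2 Summary table (p. 652)] [cite: Lange2023AbelianVarietiesComplex, §2.6.1 Proposition («restriction» column)] -/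
theorem IsSimple.lefschetzIdentityC_eq_lefschetzGroupC_of_odd (hX : IsSimple Ψ) (hη : IsRiemannForm Ψ η)
    (hG : G.map (Rat.cast : ℚ → ℝ) = latticeGram Ψ η) (hg : finrank ℂ E ≤ 7) (hodd : Odd (finrank ℂ E)) :
    lefschetzIdentityC Ψ G = lefschetzGroupC Ψ G :=
  hX.lefschetzIdentityC_eq_lefschetzGroupC_of_finrank_eq_one hη hG (hX.finrank_centerField_endAlgRat_eq_one_of_odd hg hodd)

/-- Odd `g ≤ 7`, irreducibility form: `I_ℂ(S(X)(ℂ))` is prime. [cite: MoonenZarhin1999LowDim, §2] [cite: Milne1999LefschetzClasses, §2 Summary table (p. 652)] -/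
theorem IsSimple.isPrime_vanishingIdealC_lefschetzGroupC_of_odd (hX : IsSimple Ψ) (hη : IsRiemannForm Ψ η)
    (hG : G.map (Rat.cast : ℚ → ℝ) = latticeGram Ψ η) (hg : finrank ℂ E ≤ 7) (hodd : Odd (finrank ℂ E)) :
    (vanishingIdealC (lefschetzGroupC Ψ G)).IsPrime :=
  hX.isPrime_vanishingIdealC_lefschetzGroupC_of_finrank_eq_one hη hG
    (hX.finrank_centerField_endAlgRat_eq_one_of_odd hg hodd)

/-- Odd `g ≤ 7`, real points: `Lf(X)(ℝ) = S(X)(ℝ)`. [cite: MoonenZarhin1999LowDim, §2] [cite: Milne1999LefschetzClasses, §2 Summary table (p. 652)] -/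
theorem IsSimple.lefschetzIdentity_eq_lefschetzGroup_of_odd (hX : IsSimple Ψ) (hη : IsRiemannForm Ψ η)
    (hG : G.map (Rat.cast : ℚ → ℝ) = latticeGram Ψ η) (hg : finrank ℂ E ≤ 7) (hodd : Odd (finrank ℂ E)) :
    lefschetzIdentity Ψ G = lefschetzGroup Ψ η :=
  hX.lefschetzIdentity_eq_lefschetzGroup_of_finrank_eq_one hη hG
    (hX.finrank_centerField_endAlgRat_eq_one_of_odd hg hodd)

end Simple

/-! ## §2 Isogeny products of simple factors: «connected iff no factor of type III» -/

section IsogenyFactors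

variable {K : Type*} [Fintype K] [DecidableEq K] {σ : K → Type} [∀ k, Fintype (σ k)] [∀ k, DecidableEq (σ k)]
  [∀ k, Nonempty (σ k)] {F : K → Type*} [∀ k, NormedAddCommGroup (F k)] [∀ k, NormedSpace ℂ (F k)]
  [∀ k, FiniteDimensional ℂ (F k)] {Ψ : ∀ k, (σ k → ℝ) ≃L[ℝ] F k} {ω : ∀ k, F k [⋀^Fin 2]→L[ℝ] ℝ}
  {G : ∀ k, Matrix (σ k) (σ k) ℚ} {n : K → ℕ}
  {ι : Type*} [Fintype ι] [DecidableEq ι] {E : Type*} [NormedAddCommGroup E] [NormedSpace ℂ E]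
  {Φ : (ι → ℝ) ≃L[ℝ] E} {η : E [⋀^Fin 2]→L[ℝ] ℝ} {G₀ : Matrix ι ι ℚ}

/-- **`X ∼ ∏ B_k^{n_k}` with every simple factor of Albert type I, II or IV (`d = 1`) has connected `S(X)`:
`Lf(X)(ℂ) = S(X)(ℂ)`** (Milne Prop. 1.5 and the table; `Hom_ℚ(B_k, B_l) = 0` for `k ≠ l`, `n_k ≥ 1`).
[cite: Milne1999LefschetzClasses, §1 Prop. 1.5 (p. 644) and §2 Summary table (p. 652)] -/
theorem IsIsogenous.lefschetzIdentityC_eq_lefschetzGroupC_of_powers_of_isAlbertType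
    (hX : IsIsogenous Φ (sigmaPiPeriod fun k ↦ powPeriod (Ψ k) (n k))) (hη : IsRiemannForm Φ η)
    (hG₀ : G₀.map (Rat.cast : ℚ → ℝ) = latticeGram Φ η) (h : ∀ k, IsRiemannForm (Ψ k) (ω k))
    (hG : ∀ k, (G k).map (Rat.cast : ℚ → ℝ) = latticeGram (Ψ k) (ω k))
    (hhom : ∀ k l, k ≠ l → homRat (Ψ l) (Ψ k) = ⊥) (hn : ∀ k, 0 < n k) (hs : ∀ k, IsSimple (Ψ k))
    (htype : ∀ k, IsAlbertTypeI (centerField (Ψ k) (hs k)) (endAlgRat (Ψ k)) (rosatiEnd (Ψ k) (h k).1 (h k).2.2 (hG k)) ∨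
      IsAlbertTypeII (centerField (Ψ k) (hs k)) (endAlgRat (Ψ k)) (rosatiEnd (Ψ k) (h k).1 (h k).2.2 (hG k)) ∨
        (IsAlbertTypeIV (centerField (Ψ k) (hs k)) (endAlgRat (Ψ k)) (rosatiEnd (Ψ k) (h k).1 (h k).2.2 (hG k)) ∧
          finrank (centerField (Ψ k) (hs k)) (endAlgRat (Ψ k)) = 1)) :
    lefschetzIdentityC Φ G₀ = lefschetzGroupC Φ G₀ :=
  hX.lefschetzIdentityC_eq_lefschetzGroupC_of_powers hη hG₀ h hG hhom hn fun k ↦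
    (hs k).lefschetzIdentityC_eq_lefschetzGroupC_of_isAlbertType (h k) (hG k) (htype k)

/-- **«`S(X)` IS CONNECTED IFF `X` HAS NO ISOGENY FACTOR OF TYPE III»** for `X ∼ ∏ B_k^{n_k}` with simple factors
of dimension `≤ 7` whose type-IV endomorphism algebras have `d = 1`: `Lf(X)(ℂ) = S(X)(ℂ) ⟺` no `B_k` is of Albert
type III (Milne's table through Prop. 1.5; the hypothesis of Prop. 4.8 and of Gordon's Thm. 7.5 (2)).
[cite: Milne1999LefschetzClasses, §1 Prop. 1.5, §2 Summary table (p. 652) and Remark 4.9 (p. 661)]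
[cite: Lange2023AbelianVarietiesComplex, §2.6.1 Proposition] -/
theorem IsIsogenous.lefschetzIdentityC_eq_lefschetzGroupC_iff_forall_not_isAlbertTypeIII_of_powers
    (hX : IsIsogenous Φ (sigmaPiPeriod fun k ↦ powPeriod (Ψ k) (n k))) (hη : IsRiemannForm Φ η)
    (hG₀ : G₀.map (Rat.cast : ℚ → ℝ) = latticeGram Φ η) (h : ∀ k, IsRiemannForm (Ψ k) (ω k))
    (hG : ∀ k, (G k).map (Rat.cast : ℚ → ℝ) = latticeGram (Ψ k) (ω k))
    (hhom : ∀ k l, k ≠ l → homRat (Ψ l) (Ψ k) = ⊥) (hn : ∀ k, 0 < n k) (hs : ∀ k, IsSimple (Ψ k))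
    (hg : ∀ k, finrank ℂ (F k) ≤ 7)
    (hIV : ∀ k, IsAlbertTypeIV (centerField (Ψ k) (hs k)) (endAlgRat (Ψ k)) (rosatiEnd (Ψ k) (h k).1 (h k).2.2 (hG k)) →
      finrank (centerField (Ψ k) (hs k)) (endAlgRat (Ψ k)) = 1) :
    lefschetzIdentityC Φ G₀ = lefschetzGroupC Φ G₀ ↔
      ∀ k, ¬ IsAlbertTypeIII (centerField (Ψ k) (hs k)) (endAlgRat (Ψ k)) (rosatiEnd (Ψ k) (h k).1 (h k).2.2 (hG k)) := by
  rw [hX.lefschetzIdentityC_eq_lefschetzGroupC_iff_of_powers hη hG₀ h hG hhom hn]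
  exact forall_congr' fun k ↦
    (hs k).lefschetzIdentityC_eq_lefschetzGroupC_iff_not_isAlbertTypeIII (h k) (hG k) (hg k) (hIV k)

/-- **`X ∼ ∏ B_k^{n_k}` with all simple factors of ODD dimension `≤ 7` has connected `S(X)`** (no factor can be of
type II, III or IV with `d > 1`). [cite: MoonenZarhin1999LowDim, §2] [cite: Milne1999LefschetzClasses, §1 Prop. 1.5 and §2 Summary table (p. 652)] -/
theorem IsIsogenous.lefschetzIdentityC_eq_lefschetzGroupC_of_powers_of_odd
    (hX : IsIsogenous Φ (sigmaPiPeriod fun k ↦ powPeriod (Ψ k) (n k))) (hη : IsRiemannForm Φ η)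
    (hG₀ : G₀.map (Rat.cast : ℚ → ℝ) = latticeGram Φ η) (h : ∀ k, IsRiemannForm (Ψ k) (ω k))
    (hG : ∀ k, (G k).map (Rat.cast : ℚ → ℝ) = latticeGram (Ψ k) (ω k))
    (hhom : ∀ k l, k ≠ l → homRat (Ψ l) (Ψ k) = ⊥) (hn : ∀ k, 0 < n k) (hs : ∀ k, IsSimple (Ψ k))
    (hg : ∀ k, finrank ℂ (F k) ≤ 7) (hodd : ∀ k, Odd (finrank ℂ (F k))) :
    lefschetzIdentityC Φ G₀ = lefschetzGroupC Φ G₀ :=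
  hX.lefschetzIdentityC_eq_lefschetzGroupC_of_powers hη hG₀ h hG hhom hn fun k ↦
    (hs k).lefschetzIdentityC_eq_lefschetzGroupC_of_odd (h k) (hG k) (hg k) (hodd k)

end IsogenyFactors

end ComplexTorus

end Literature.Geometry.Kaehler
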